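import Summits.Ventures.YMGap.RobustBall.SummableMassiveBridge
import Summits.Ventures.YMGap.RobustBall.RowsS
import Summits.Ventures.YMGap.RobustBall.MassGapOnBallMassive
import HarnessLib

/-!
# Venture YMGap, track ROBUST-BALL (tier 2) — «EVERY DLR STATE OF EVERY MEMBER OF THE WEIGHTED
# (INFINITE-RANGE) BALL IS MASSIVE»: the `d = 4` conversion, the every-`d` clause, the hypothesis-free
# `SU(2)` form and the all-`N` Bakry–Émery form

HONEST FRAMING. WHAT THIS IS: a venture file (cell `pub-ymgap`, track Y2 ROBUST-BALL, seat ds-3),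
strong-coupling LATTICE statement for `SU(N)` lattice Yang–Mills on `ℤ^d` with a PERTURBED action
`N β S_W + W`, `W` in rb-p1's TIER-2 ball `MemBallZdS a Λ t` (summable, infinite-range link potentials with
oscillation load `a` and diagonal-free `e^{t‖·‖_∞}`-weighted cross-Lipschitz load `Λ`). The tier-2 twin of the
seat's `MassGapOnBallMassive.lean`: the seat's bridge `perturbedS_covariance_decay_quasilocal` turns the
weighted ROW CONDITION of rb-p1's tier-2 theorem (`perturbed_covariance_decay_S`, §5 row 1g of
`ROBUST-BALL-STATEMENT.md`) into MASSIVENESS of every DLR state of the member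
(`Literature.Barriers.QuantumFields.IsMassiveState`: ONE rate for the truncated correlations of ALL bounded
measurable local observables — here the rate `t` of the weight) with exponentially decaying plaquette–plaquette
correlation function, for `d = 4` (`massive_onBallZdS_of_pair`), and the Osterwalder–Seiler clause in every
`d ≥ 1` (`massiveClause_onBallZdS_of_pair`). DOOR-LEVEL, NOT CURRENCY-LEVEL: the hypothesis is the row condition
(one-link pair + loads), not the currency `MassGapOnBallZdS d N β a Λ t` — the abstract clause `∀ n, ∃ c₁(n)`
of `PerturbedMassGapAtS` does not control the growth of `c₁(n)`, which the infinite-range smoothing needs; every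
row of §5 row 1g is certified through exactly this row condition, so each converts cell by cell
(`RowsSMassive.lean`). Hypothesis-free instances: `SU(2)` with the sharp pair
`(2/3, 8/3)` — `2(d−1)|β_W| e^{a} e^{t} + e^{a/2} √(2/3) Λ < 1` (`su2_massive_onBallZdS_dim4`,
`su2_massiveClause_onBallZdS`), with the sharp variance (lineage B, `|β_W| ≤ 1/6`: `su2_massive_onBallZdS_sharp`)
— and every `N ≥ 2` with the Bakry–Émery pair
(`suN_massive_onBallZdS_bakryEmery_dim4`); `SU(3)` CONDITIONALLY on the cell's certificates H1/H2
(`su3_massive_onBallZdS_of_certificates`). The certified cells of row 1g become massive rows in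
`RowsSMassive.lean`. WHAT IT IS NOT: no new threshold, no new `(β⋆, ε)` number; nothing about the continuum,
confinement, a transfer-matrix gap or the Clay problem.

References: H. Föllmer, LNM 1362 (1988) Ch. I Thm. (2.13); K. Osterwalder, E. Seiler, Ann. Phys. 110 (1978)
440, §4; H. Shen, R. Zhu, X. Zhu, CMP 400 (2023) 805–851; rb-theory `HOME/rb/ROBUST-BALL-STATEMENT.md` §5 row 1g.
-/

noncomputable section

open MeasureTheory ProbabilityTheory Function Finset Filter Topology
open scoped NNReal
open Literature.Probability.LatticeModels
open Literature.Probability.LatticeModels.DobrushinMetric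
open Literature.MathematicalPhysics.QuantumLattice
open Literature.MathematicalPhysics.QuantumFieldTheory hiding ZdEdge
open Literature.MathematicalPhysics.QuantumFieldTheory.Balaban1983to89
open Literature.MathematicalPhysics.QuantumFieldTheory.Balaban1983to89.StrongCouplingTorusWindow
open Literature.Barriers.QuantumFields (IsMassiveState)
open Summit.QuantumFields.BalabanUV.InfraRed.StrongCouplingPoincareDoorSUN (OneLinkPoincareSUN OneLinkPoincareSUN.mono
  oneLinkPoincareSUN_two_sharp oneLinkPoincareSUN_bakryEmery)
open Summit.QuantumFields.BalabanUV.InfraRed.StrongCouplingVarianceDoorSUN (OneLinkVarianceBound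
  oneLinkVarianceBound_bakryEmery)

namespace Summit.Ventures.YMGap.RobustBall

variable {d N : ℕ}

/-! ### Every member of the tier-2 ball under the row condition: the clause (every `d`), massiveness (`d = 4`) -/

section Pair

/-- **EVERY `d ≥ 1`: THE OSTERWALDER–SEILER CLAUSE FOR EVERY DLR STATE OF EVERY MEMBER OF THE TIER-2 BALL**
(`SU(N)`, `N ≥ 1`, 't Hooft `β`, tree coupling `N β`): for a one-link Poincaré/variance pair `(c, v)` on the
staple ball `‖B‖_op ≤ b ⊇ 2(d−1)|β|`, a weight `t > 0` and loads `(a, Λ)` with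
`6(d−1)|β| e^{a} e^{t} √(c v) + e^{a/2} √c Λ < 1`, every DLR state `μ` of every member `W ∈ MemBallZdS a Λ t`
has the rate `t` at which `cov_μ(F₁, F₂ ∘ θ_x)` decays exponentially for ALL bounded measurable local
observables `F₁, F₂` (the body of `IsMassiveState` with `4 ↦ d`, gauge-invariance binders dropped). -/
theorem massiveClause_onBallZdS_of_pair (hd : 1 ≤ d) (hN : 1 ≤ N) {β b c v a Λ t : ℝ}
    (hc : 0 ≤ c) (hv : 0 ≤ v) (hb : |β| * (2 * ((d : ℝ) - 1)) ≤ b)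
    (hP : ∀ B : Matrix (Fin N) (Fin N) ℂ, matrixOpNorm B ≤ b →
      ∀ (ψ : Matrix.specialUnitaryGroup (Fin N) ℂ → ℝ) (M : ℝ), 0 ≤ M →
        (∀ x y, |ψ x - ψ y| ≤ M * suFrobDist x y) →
        Var[ψ; (haarProbability (Matrix.specialUnitaryGroup (Fin N) ℂ)).tilted
          fun g => (N : ℝ) * ((g : Matrix (Fin N) (Fin N) ℂ) * B).trace.re] ≤ c * M ^ 2)
    (hVB : ∀ B : Matrix (Fin N) (Fin N) ℂ, matrixOpNorm B ≤ b → ∀ Δ : Matrix (Fin N) (Fin N) ℂ,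
      Var[fun g : Matrix.specialUnitaryGroup (Fin N) ℂ =>
          (N : ℝ) * ((g : Matrix (Fin N) (Fin N) ℂ) * Δ).trace.re;
        (haarProbability (Matrix.specialUnitaryGroup (Fin N) ℂ)).tilted
          fun g => (N : ℝ) * ((g : Matrix (Fin N) (Fin N) ℂ) * B).trace.re] ≤ v * frobNorm Δ ^ 2)
    (ht : 0 < t)
    (hρ : 6 * ((d : ℝ) - 1) * |β| * (Real.exp a * Real.exp t * Real.sqrt (c * v)) +
      Real.exp (a / 2) * Real.sqrt c * Λ < 1)
    {W : Potential (ZdEdge d) (Matrix.specialUnitaryGroup (Fin N) ℂ)} (hW : MemBallZdS a Λ t W) :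
    ∀ μ ∈ perturbedGibbsMeasuresS (d := d) (fundamentalRep (Fin N)) ((N : ℝ) * β) W,
      ∃ m : ℝ, ∀ F₁ F₂ : LGConfig d (Matrix.specialUnitaryGroup (Fin N) ℂ) → ℝ,
        Literature.MathematicalPhysics.QuantumLattice.IsLocalObservable F₁ →
        Literature.MathematicalPhysics.QuantumLattice.IsLocalObservable F₂ →
        Measurable F₁ → Measurable F₂ → (∃ C, ∀ U, |F₁ U| ≤ C) → (∃ C, ∀ U, |F₂ U| ≤ C) →
          HasExponentialDecayRate
            (fun x : Site d => cov[F₁, fun U => F₂ (Literature.MathematicalPhysics.QuantumLattice.configShift x U); μ]) m := by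
  intro μ hμ
  obtain ⟨B, hB⟩ := hW.summable
  obtain ⟨osc, lip, ℓ, hosc, hlip, hoscs, hosca, hlips, hℓ, hℓs, hℓt⟩ := hW.loads
  refine ⟨t, fun F₁ F₂ h₁ h₂ h₁m h₂m hb₁ hb₂ => ⟨ht, ?_⟩⟩
  exact perturbedS_covariance_decay_quasilocal hd hN hc hv hb hP hVB hB hW.continuous hW.dependsOn hosc hoscs
    hosca hlip hlips hℓ ht.le hℓs hℓt hρ hμ F₁ F₂ h₁ h₂ h₁m h₂m hb₁ hb₂

/-- **Plaquette–plaquette decay for every DLR state of every member of the tier-2 ball, every `d ≥ 1`**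
(tree criterion `not_exists_clusteringRate_of_not_hasExponentialDecay_plaquetteCorrFn` applied to the clause). -/
theorem hasExponentialDecay_plaquetteCorrFn_onBallZdS_of_pair [NeZero d] (hd : 1 ≤ d) (hN : 1 ≤ N)
    {β b c v a Λ t : ℝ}
    (hc : 0 ≤ c) (hv : 0 ≤ v) (hb : |β| * (2 * ((d : ℝ) - 1)) ≤ b)
    (hP : ∀ B : Matrix (Fin N) (Fin N) ℂ, matrixOpNorm B ≤ b →
      ∀ (ψ : Matrix.specialUnitaryGroup (Fin N) ℂ → ℝ) (M : ℝ), 0 ≤ M →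
        (∀ x y, |ψ x - ψ y| ≤ M * suFrobDist x y) →
        Var[ψ; (haarProbability (Matrix.specialUnitaryGroup (Fin N) ℂ)).tilted
          fun g => (N : ℝ) * ((g : Matrix (Fin N) (Fin N) ℂ) * B).trace.re] ≤ c * M ^ 2)
    (hVB : ∀ B : Matrix (Fin N) (Fin N) ℂ, matrixOpNorm B ≤ b → ∀ Δ : Matrix (Fin N) (Fin N) ℂ,
      Var[fun g : Matrix.specialUnitaryGroup (Fin N) ℂ =>
          (N : ℝ) * ((g : Matrix (Fin N) (Fin N) ℂ) * Δ).trace.re;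
        (haarProbability (Matrix.specialUnitaryGroup (Fin N) ℂ)).tilted
          fun g => (N : ℝ) * ((g : Matrix (Fin N) (Fin N) ℂ) * B).trace.re] ≤ v * frobNorm Δ ^ 2)
    (ht : 0 < t)
    (hρ : 6 * ((d : ℝ) - 1) * |β| * (Real.exp a * Real.exp t * Real.sqrt (c * v)) +
      Real.exp (a / 2) * Real.sqrt c * Λ < 1)
    {W : Potential (ZdEdge d) (Matrix.specialUnitaryGroup (Fin N) ℂ)} (hW : MemBallZdS a Λ t W) :
    ∀ μ ∈ perturbedGibbsMeasuresS (d := d) (fundamentalRep (Fin N)) ((N : ℝ) * β) W,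
      HasExponentialDecay (plaquetteCorrFn (fundamentalRep (Fin N)) μ) := by
  intro μ hμ
  haveI : SecondCountableTopology (Matrix (Fin N) (Fin N) ℂ) :=
    inferInstanceAs (SecondCountableTopology (Fin N → Fin N → ℂ))
  haveI : SecondCountableTopology (Matrix.specialUnitaryGroup (Fin N) ℂ) :=
    Topology.IsEmbedding.subtypeVal.secondCountableTopology
  have hGibbs : IsGibbsMeasure (perturbedYMS (d := d) (fundamentalRep (Fin N)) ((N : ℝ) * β) W) μ := hμ
  haveI : IsProbabilityMeasure μ := hGibbs.isProbabilityMeasure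
  obtain ⟨m, hm⟩ := massiveClause_onBallZdS_of_pair hd hN hc hv hb hP hVB ht hρ hW μ hμ
  by_contra hneg
  exact Literature.Barriers.QuantumFields.not_exists_clusteringRate_of_not_hasExponentialDecay_plaquetteCorrFn
    (fundamentalRep (Fin N)) (continuous_fundamentalRep (Fin N))
    (fun U => fundamentalRep_mem_unitaryGroup U) hneg
    ⟨m, fun F₁ F₂ h₁ h₂ h₁m h₂m hb₁ hb₂ _ _ => hm F₁ F₂ h₁ h₂ h₁m h₂m hb₁ hb₂⟩

/-- ★ **`d = 4`: EVERY DLR STATE OF EVERY MEMBER OF THE TIER-2 BALL IS MASSIVE** (`SU(N)`, `N ≥ 1`, 't Hooft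
`β`): for a one-link pair `(c, v)` on the staple ball, a weight `t > 0` and loads `(a, Λ)` with
`18|β| e^{a} e^{t} √(c v) + e^{a/2} √c Λ < 1`, every member `W ∈ MemBallZdS a Λ t` of the weighted ball —
summable, INFINITE-RANGE link potentials included — has DLR states (`perturbedGibbsMeasuresS_nonempty`), and
EVERY DLR state is an Osterwalder–Seiler MASSIVE STATE (`IsMassiveState`, rate `t`) with exponentially decaying
plaquette–plaquette correlation function. (rb-p1's `perturbedMassGapS_SU` adds: exactly one DLR state.) -/
theorem massive_onBallZdS_of_pair (hN : 1 ≤ N) {β b c v a Λ t : ℝ}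
    (hc : 0 ≤ c) (hv : 0 ≤ v) (hb : |β| * (2 * (((4 : ℕ) : ℝ) - 1)) ≤ b)
    (hP : ∀ B : Matrix (Fin N) (Fin N) ℂ, matrixOpNorm B ≤ b →
      ∀ (ψ : Matrix.specialUnitaryGroup (Fin N) ℂ → ℝ) (M : ℝ), 0 ≤ M →
        (∀ x y, |ψ x - ψ y| ≤ M * suFrobDist x y) →
        Var[ψ; (haarProbability (Matrix.specialUnitaryGroup (Fin N) ℂ)).tilted
          fun g => (N : ℝ) * ((g : Matrix (Fin N) (Fin N) ℂ) * B).trace.re] ≤ c * M ^ 2)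
    (hVB : ∀ B : Matrix (Fin N) (Fin N) ℂ, matrixOpNorm B ≤ b → ∀ Δ : Matrix (Fin N) (Fin N) ℂ,
      Var[fun g : Matrix.specialUnitaryGroup (Fin N) ℂ =>
          (N : ℝ) * ((g : Matrix (Fin N) (Fin N) ℂ) * Δ).trace.re;
        (haarProbability (Matrix.specialUnitaryGroup (Fin N) ℂ)).tilted
          fun g => (N : ℝ) * ((g : Matrix (Fin N) (Fin N) ℂ) * B).trace.re] ≤ v * frobNorm Δ ^ 2)
    (ht : 0 < t)
    (hρ : 6 * (((4 : ℕ) : ℝ) - 1) * |β| * (Real.exp a * Real.exp t * Real.sqrt (c * v)) +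
      Real.exp (a / 2) * Real.sqrt c * Λ < 1)
    {W : Potential (ZdEdge 4) (Matrix.specialUnitaryGroup (Fin N) ℂ)} (hW : MemBallZdS a Λ t W) :
    (perturbedGibbsMeasuresS (d := 4) (fundamentalRep (Fin N)) ((N : ℝ) * β) W).Nonempty ∧
      ∀ μ ∈ perturbedGibbsMeasuresS (d := 4) (fundamentalRep (Fin N)) ((N : ℝ) * β) W,
        IsMassiveState μ ∧ HasExponentialDecay (plaquetteCorrFn (fundamentalRep (Fin N)) μ) := by
  haveI : SecondCountableTopology (Matrix (Fin N) (Fin N) ℂ) :=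
    inferInstanceAs (SecondCountableTopology (Fin N → Fin N → ℂ))
  haveI : SecondCountableTopology (Matrix.specialUnitaryGroup (Fin N) ℂ) :=
    Topology.IsEmbedding.subtypeVal.secondCountableTopology
  obtain ⟨B, hB⟩ := hW.summable
  refine ⟨perturbedGibbsMeasuresS_nonempty _ (continuous_fundamentalRep (Fin N)) _ hB hW.continuous hW.dependsOn,
    fun μ hμ => ⟨?_, hasExponentialDecay_plaquetteCorrFn_onBallZdS_of_pair (by norm_num) hN hc hv hb hP hVB ht
      hρ hW μ hμ⟩⟩
  obtain ⟨m, hm⟩ := massiveClause_onBallZdS_of_pair (d := 4) (by norm_num) hN hc hv hb hP hVB ht hρ hW μ hμ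
  exact ⟨m, fun F₁ F₂ h₁ h₂ h₁m h₂m hb₁ hb₂ _ _ => hm F₁ F₂ h₁ h₂ h₁m h₂m hb₁ hb₂⟩

end Pair

/-! ### `SU(2)`, hypothesis-free: the sharp pair `(c, v) = (2/3, 8/3)` -/

/-- The sharp `SU(2)` one-link pair at every drift (`oneLinkPoincareSUN_two_sharp`, `linVariance_of_poincare`):
Poincaré constant `2/3` and linear variance `(2/3)·2²`, in the shape consumed by the bridge. -/
theorem su2_oneLinkPair (b : ℝ) :
    (∀ B : Matrix (Fin 2) (Fin 2) ℂ, matrixOpNorm B ≤ b →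
      ∀ (ψ : Matrix.specialUnitaryGroup (Fin 2) ℂ → ℝ) (M : ℝ), 0 ≤ M →
        (∀ x y, |ψ x - ψ y| ≤ M * suFrobDist x y) →
        Var[ψ; (haarProbability (Matrix.specialUnitaryGroup (Fin 2) ℂ)).tilted
          fun g => ((2 : ℕ) : ℝ) * ((g : Matrix (Fin 2) (Fin 2) ℂ) * B).trace.re] ≤ 2 / 3 * M ^ 2) ∧
    (∀ B : Matrix (Fin 2) (Fin 2) ℂ, matrixOpNorm B ≤ b → ∀ Δ : Matrix (Fin 2) (Fin 2) ℂ,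
      Var[fun g : Matrix.specialUnitaryGroup (Fin 2) ℂ =>
          ((2 : ℕ) : ℝ) * ((g : Matrix (Fin 2) (Fin 2) ℂ) * Δ).trace.re;
        (haarProbability (Matrix.specialUnitaryGroup (Fin 2) ℂ)).tilted
          fun g => ((2 : ℕ) : ℝ) * ((g : Matrix (Fin 2) (Fin 2) ℂ) * B).trace.re] ≤
        2 / 3 * ((2 : ℕ) : ℝ) ^ 2 * frobNorm Δ ^ 2) := by
  have hP : ∀ B : Matrix (Fin 2) (Fin 2) ℂ, matrixOpNorm B ≤ b →
      ∀ (ψ : Matrix.specialUnitaryGroup (Fin 2) ℂ → ℝ) (M : ℝ), 0 ≤ M →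
        (∀ x y, |ψ x - ψ y| ≤ M * suFrobDist x y) →
        Var[ψ; (haarProbability (Matrix.specialUnitaryGroup (Fin 2) ℂ)).tilted
          fun g => ((2 : ℕ) : ℝ) * ((g : Matrix (Fin 2) (Fin 2) ℂ) * B).trace.re] ≤ 2 / 3 * M ^ 2 :=
    fun B hB ψ M hM hψ => oneLinkPoincareSUN_two_sharp _ B hB ψ M hM hψ
  exact ⟨hP, linVariance_of_poincare (N := 2) hP⟩

/-- The `SU(2)` row sum in the pair form equals the displayed one: `√((2/3)·(2/3)·2²) = 4/3` and
`6(d−1)|β_W/4|·(4/3) = 2(d−1)|β_W|`. -/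
theorem su2_rowSum_eq (d : ℕ) (βW a t Λ : ℝ) :
    6 * ((d : ℝ) - 1) * |βW / 4| * (Real.exp a * Real.exp t * Real.sqrt (2 / 3 * (2 / 3 * ((2 : ℕ) : ℝ) ^ 2))) +
        Real.exp (a / 2) * Real.sqrt (2 / 3) * Λ =
      2 * ((d : ℝ) - 1) * |βW| * (Real.exp a * Real.exp t) + Real.exp (a / 2) * Real.sqrt (2 / 3) * Λ := by
  have hsq : Real.sqrt (2 / 3 * (2 / 3 * ((2 : ℕ) : ℝ) ^ 2)) = 4 / 3 := by
    rw [show (2 / 3 * (2 / 3 * ((2 : ℕ) : ℝ) ^ 2) : ℝ) = (4 / 3) ^ 2 by norm_num, Real.sqrt_sq (by norm_num)]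
  rw [hsq, abs_div, abs_of_pos (by norm_num : (0 : ℝ) < 4)]
  ring

/-- ★ **EVERY `d ≥ 1`, `SU(2)`, HYPOTHESIS-FREE: the Osterwalder–Seiler clause on the tier-2 ball** (Wilson
units, 't Hooft `β_W/4`, tree coupling `(2:ℕ)·(β_W/4) = β_W/2`): for a weight `t > 0` and loads `(a, Λ)` with
`2(d−1)|β_W| e^{a} e^{t} + e^{a/2} √(2/3) Λ < 1`, every DLR state of every member of `MemBallZdS a Λ t` added to
`SU(2)` Wilson at `β_W` on `ℤ^d` clusters exponentially AT RATE `t`, for all bounded measurable local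
observables. -/
theorem su2_massiveClause_onBallZdS (hd : 1 ≤ d) {βW a Λ t : ℝ} (ht : 0 < t)
    (hρ : 2 * ((d : ℝ) - 1) * |βW| * (Real.exp a * Real.exp t) + Real.exp (a / 2) * Real.sqrt (2 / 3) * Λ < 1)
    {W : Potential (ZdEdge d) (Matrix.specialUnitaryGroup (Fin 2) ℂ)} (hW : MemBallZdS a Λ t W) :
    ∀ μ ∈ perturbedGibbsMeasuresS (d := d) (fundamentalRep (Fin 2)) (((2 : ℕ) : ℝ) * (βW / 4)) W,
      ∃ m : ℝ, ∀ F₁ F₂ : LGConfig d (Matrix.specialUnitaryGroup (Fin 2) ℂ) → ℝ,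
        Literature.MathematicalPhysics.QuantumLattice.IsLocalObservable F₁ →
        Literature.MathematicalPhysics.QuantumLattice.IsLocalObservable F₂ →
        Measurable F₁ → Measurable F₂ → (∃ C, ∀ U, |F₁ U| ≤ C) → (∃ C, ∀ U, |F₂ U| ≤ C) →
          HasExponentialDecayRate
            (fun x : Site d => cov[F₁, fun U => F₂ (Literature.MathematicalPhysics.QuantumLattice.configShift x U); μ]) m := by
  obtain ⟨hP, hVB⟩ := su2_oneLinkPair (|βW / 4| * (2 * ((d : ℝ) - 1)))
  refine massiveClause_onBallZdS_of_pair hd (by norm_num) (by norm_num) (by norm_num) le_rfl hP hVB ht ?_ hW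
  rw [su2_rowSum_eq]
  exact hρ

/-- ★★ **`d = 4`, `SU(2)`, HYPOTHESIS-FREE: EVERY DLR STATE OF EVERY MEMBER OF THE TIER-2 BALL IS MASSIVE**
(Wilson units): for a weight `t > 0` and loads `(a, Λ)` with `6|β_W| e^{a} e^{t} + e^{a/2} √(2/3) Λ < 1`, every
member `W ∈ MemBallZdS a Λ t` — a summable, possibly INFINITE-RANGE, continuous adapted link potential with
oscillation load `a` and `e^{t‖·‖_∞}`-weighted cross-Lipschitz load `Λ` — added to the `SU(2)` Wilson action at
`β_W` on `ℤ⁴` has DLR states, and EVERY one of them is a MASSIVE STATE (`IsMassiveState`, rate `t`) whose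
plaquette–plaquette correlation function decays exponentially. At `t → 0⁺` formally the tier-1 window
`6|β_W| e^{ε₀} + e^{ε₀/2} √(2/3) ε₁ < 1` of `su2_massive_onBallZd_dim4`. -/
theorem su2_massive_onBallZdS_dim4 {βW a Λ t : ℝ} (ht : 0 < t)
    (hρ : 6 * |βW| * (Real.exp a * Real.exp t) + Real.exp (a / 2) * Real.sqrt (2 / 3) * Λ < 1)
    {W : Potential (ZdEdge 4) (Matrix.specialUnitaryGroup (Fin 2) ℂ)} (hW : MemBallZdS a Λ t W) :
    (perturbedGibbsMeasuresS (d := 4) (fundamentalRep (Fin 2)) (((2 : ℕ) : ℝ) * (βW / 4)) W).Nonempty ∧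
      ∀ μ ∈ perturbedGibbsMeasuresS (d := 4) (fundamentalRep (Fin 2)) (((2 : ℕ) : ℝ) * (βW / 4)) W,
        IsMassiveState μ ∧ HasExponentialDecay (plaquetteCorrFn (fundamentalRep (Fin 2)) μ) := by
  obtain ⟨hP, hVB⟩ := su2_oneLinkPair (|βW / 4| * (2 * (((4 : ℕ) : ℝ) - 1)))
  refine massive_onBallZdS_of_pair (by norm_num) (by norm_num) (by norm_num) le_rfl hP hVB ht ?_ hW
  rw [su2_rowSum_eq]
  have h6 : (2 : ℝ) * (((4 : ℕ) : ℝ) - 1) = 6 := by norm_num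
  calc 2 * (((4 : ℕ) : ℝ) - 1) * |βW| * (Real.exp a * Real.exp t) + Real.exp (a / 2) * Real.sqrt (2 / 3) * Λ
      = 6 * |βW| * (Real.exp a * Real.exp t) + Real.exp (a / 2) * Real.sqrt (2 / 3) * Λ := by rw [h6]
    _ < 1 := hρ

/-- **Wilson-coupling reading** (tree coupling `β_W/2`): under `6|β_W| e^{a} e^{t} + e^{a/2} √(2/3) Λ < 1`,
`t > 0`, every DLR state of `perturbedYMS (fundamentalRep (Fin 2)) (β_W/2) W`, `W ∈ MemBallZdS a Λ t`, is massive
with plaquette–plaquette decay. -/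
theorem su2_isMassiveState_onBallZdS_wilson {βW a Λ t : ℝ} (ht : 0 < t)
    (hρ : 6 * |βW| * (Real.exp a * Real.exp t) + Real.exp (a / 2) * Real.sqrt (2 / 3) * Λ < 1)
    {W : Potential (ZdEdge 4) (Matrix.specialUnitaryGroup (Fin 2) ℂ)} (hW : MemBallZdS a Λ t W) :
    ∀ μ ∈ perturbedGibbsMeasuresS (d := 4) (fundamentalRep (Fin 2)) (βW / 2) W,
      IsMassiveState μ ∧ HasExponentialDecay (plaquetteCorrFn (fundamentalRep (Fin 2)) μ) := by
  have e : (((2 : ℕ) : ℝ) * (βW / 4)) = βW / 2 := by push_cast; ring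
  rw [← e]
  exact (su2_massive_onBallZdS_dim4 ht hρ hW).2

/-- **`d = 4`, `SU(2)`, SHARP VARIANCE (lineage B), HYPOTHESIS-FREE** (pair `(2/3, 2)` on `‖B‖_op ≤ 1/4`, i.e.
`|β_W| ≤ 1/6`; `su2_linVariance_sharp`): `3√3 |β_W| e^{a} e^{t} + e^{a/2} √(2/3) Λ < 1`, `t > 0` ⇒ every member
of `MemBallZdS a Λ t` added to `SU(2)` Wilson at `β_W` on `ℤ⁴` has DLR states, all MASSIVE (rate `t`) with
plaquette–plaquette decay (the massive twin of rb-p1's `su2_massGapOnBallZdS_sharp`). -/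
theorem su2_massive_onBallZdS_sharp {βW a Λ t : ℝ} (hβ : |βW| ≤ 1 / 6) (ht : 0 < t)
    (hρ : 3 * Real.sqrt 3 * |βW| * (Real.exp a * Real.exp t) + Real.exp (a / 2) * Real.sqrt (2 / 3) * Λ < 1)
    {W : Potential (ZdEdge 4) (Matrix.specialUnitaryGroup (Fin 2) ℂ)} (hW : MemBallZdS a Λ t W) :
    (perturbedGibbsMeasuresS (d := 4) (fundamentalRep (Fin 2)) (((2 : ℕ) : ℝ) * (βW / 4)) W).Nonempty ∧
      ∀ μ ∈ perturbedGibbsMeasuresS (d := 4) (fundamentalRep (Fin 2)) (((2 : ℕ) : ℝ) * (βW / 4)) W,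
        IsMassiveState μ ∧ HasExponentialDecay (plaquetteCorrFn (fundamentalRep (Fin 2)) μ) := by
  have hc : (0 : ℝ) ≤ 2 / 3 := by norm_num
  have hb : |βW / 4| * (2 * (((4 : ℕ) : ℝ) - 1)) ≤ 1 / 4 := by
    rw [abs_div, abs_of_pos (by norm_num : (0 : ℝ) < 4)]
    norm_num
    linarith
  have hP : ∀ B : Matrix (Fin 2) (Fin 2) ℂ, matrixOpNorm B ≤ 1 / 4 →
      ∀ (ψ : Matrix.specialUnitaryGroup (Fin 2) ℂ → ℝ) (M : ℝ), 0 ≤ M →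
        (∀ x y, |ψ x - ψ y| ≤ M * suFrobDist x y) →
        Var[ψ; (haarProbability (Matrix.specialUnitaryGroup (Fin 2) ℂ)).tilted
          fun g => ((2 : ℕ) : ℝ) * ((g : Matrix (Fin 2) (Fin 2) ℂ) * B).trace.re] ≤ 2 / 3 * M ^ 2 :=
    fun B hB ψ M hM hψ => oneLinkPoincareSUN_two_sharp _ B hB ψ M hM hψ
  refine massive_onBallZdS_of_pair (N := 2) (by norm_num) hc zero_le_two hb hP (su2_linVariance_sharp le_rfl) ht ?_ hW
  have hsq : Real.sqrt (2 / 3 * 2) = 2 * Real.sqrt 3 / 3 := by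
    have h3 : (2 * Real.sqrt 3 / 3) ^ 2 = 2 / 3 * 2 := by
      rw [div_pow, mul_pow, Real.sq_sqrt (by norm_num)]; norm_num
    rw [← h3, Real.sqrt_sq (by positivity)]
  rw [hsq]
  have e : 6 * (((4 : ℕ) : ℝ) - 1) * |βW / 4| * (Real.exp a * Real.exp t * (2 * Real.sqrt 3 / 3)) =
      3 * Real.sqrt 3 * |βW| * (Real.exp a * Real.exp t) := by
    rw [abs_div, abs_of_pos (by norm_num : (0 : ℝ) < 4)]
    ring
  rw [e]
  exact hρ

/-! ### Every `N ≥ 2`, hypothesis-free: the Bakry–Émery pair -/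

/-- ★ **ALL `N ≥ 2`, `d = 4`, HYPOTHESIS-FREE — every DLR state of every member of the tier-2 ball is massive,
from the Bakry–Émery one-link pair** (`oneLinkPoincareSUN_bakryEmery`, `oneLinkVarianceBound_bakryEmery`;
`√(c v) = 1/(1/2 − b)`, `√c = 1/√(N(1/2 − b))`, `b = 6|β| < 1/2`): for `t > 0` and
`18|β| e^{a} e^{t}/(1/2 − 6|β|) + e^{a/2} Λ/√(N(1/2 − 6|β|)) < 1`, every member of `MemBallZdS a Λ t` has DLR
states and all of them are massive with plaquette–plaquette decay (the massive twin of rb-p1's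
`suN_massGapOnBallZdS_bakryEmery` at `d = 4`). -/
theorem suN_massive_onBallZdS_bakryEmery_dim4 (hN : 2 ≤ N) {β a Λ t : ℝ} (ht : 0 < t)
    (hb : |β| * (2 * (((4 : ℕ) : ℝ) - 1)) < 1 / 2)
    (hρ : 6 * (((4 : ℕ) : ℝ) - 1) * |β| * (Real.exp a * Real.exp t) / (1 / 2 - |β| * (2 * (((4 : ℕ) : ℝ) - 1))) +
      Real.exp (a / 2) * Λ / Real.sqrt ((N : ℝ) * (1 / 2 - |β| * (2 * (((4 : ℕ) : ℝ) - 1)))) < 1)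
    {W : Potential (ZdEdge 4) (Matrix.specialUnitaryGroup (Fin N) ℂ)} (hW : MemBallZdS a Λ t W) :
    (perturbedGibbsMeasuresS (d := 4) (fundamentalRep (Fin N)) ((N : ℝ) * β) W).Nonempty ∧
      ∀ μ ∈ perturbedGibbsMeasuresS (d := 4) (fundamentalRep (Fin N)) ((N : ℝ) * β) W,
        IsMassiveState μ ∧ HasExponentialDecay (plaquetteCorrFn (fundamentalRep (Fin N)) μ) := by
  set b : ℝ := |β| * (2 * (((4 : ℕ) : ℝ) - 1)) with hbdef
  have hNpos : (0 : ℝ) < N := by exact_mod_cast (show 0 < N by omega)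
  have hgap : 0 < 1 / 2 - b := by linarith
  have hP := oneLinkPoincareSUN_bakryEmery hN hb
  have hV := oneLinkVarianceBound_bakryEmery hN hb
  have hc : (0 : ℝ) ≤ 1 / ((N : ℝ) * (1 / 2 - b)) := by positivity
  have hv : (0 : ℝ) ≤ (N : ℝ) / (1 / 2 - b) := by positivity
  refine massive_onBallZdS_of_pair (by omega) hc hv le_rfl (fun B hB => hP B hB) (fun B hB => hV B hB) ht ?_ hW
  have hsq1 : Real.sqrt (1 / ((N : ℝ) * (1 / 2 - b)) * ((N : ℝ) / (1 / 2 - b))) = 1 / (1 / 2 - b) := by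
    rw [show 1 / ((N : ℝ) * (1 / 2 - b)) * ((N : ℝ) / (1 / 2 - b)) = (1 / (1 / 2 - b)) ^ 2 by field_simp,
      Real.sqrt_sq (by positivity)]
  have hsq2 : Real.sqrt (1 / ((N : ℝ) * (1 / 2 - b))) = 1 / Real.sqrt ((N : ℝ) * (1 / 2 - b)) := by
    rw [Real.sqrt_div' _ (mul_nonneg hNpos.le hgap.le), Real.sqrt_one]
  rw [hsq1, hsq2]
  calc 6 * (((4 : ℕ) : ℝ) - 1) * |β| * (Real.exp a * Real.exp t * (1 / (1 / 2 - b))) +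
        Real.exp (a / 2) * (1 / Real.sqrt ((N : ℝ) * (1 / 2 - b))) * Λ
      = 6 * (((4 : ℕ) : ℝ) - 1) * |β| * (Real.exp a * Real.exp t) / (1 / 2 - b) +
        Real.exp (a / 2) * Λ / Real.sqrt ((N : ℝ) * (1 / 2 - b)) := by ring
    _ < 1 := hρ

/-! ### `SU(3)` on the cell's certificates H1/H2 (displayed hypotheses, nothing asserted about them) -/

/-- **`SU(3)`, `d = 4`, ON THE CELL'S CERTIFICATES** H1 `OneLinkPoincareSUN 3 (3/5) (4/5)` and
H2 `OneLinkVarianceBound 3 (11/30) (49/20)` (engine-2 lineage; `√(c v) = 7/5`, `√c = √(4/5)`): for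
`3|β_W| ≤ 33/20` ('t Hooft `β = β_W/9`, radius `11/30`), `t > 0` and
`(14/15)·3|β_W| e^{a} e^{t} + e^{a/2} √(4/5) Λ < 1`, every member of `MemBallZdS a Λ t` added to `SU(3)` Wilson at `β_W`
on `ℤ⁴` has DLR states, all MASSIVE (rate `t`) with plaquette–plaquette decay — the massive twin of rb-p1's
`su3_massGapOnBallZdS_of_certificates` at `d = 4`, CONDITIONAL on H1/H2 exactly like it. -/
theorem su3_massive_onBallZdS_of_certificates {βW a Λ t : ℝ}
    (hP : OneLinkPoincareSUN 3 (3 / 5) (4 / 5)) (hV : OneLinkVarianceBound 3 (11 / 30) (49 / 20))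
    (hR : ((((4 : ℕ) : ℝ)) - 1) * |βW| ≤ 33 / 20) (ht : 0 < t)
    (hρ : 14 / 15 * (((((4 : ℕ) : ℝ)) - 1) * |βW|) * (Real.exp a * Real.exp t) +
      Real.exp (a / 2) * Real.sqrt (4 / 5) * Λ < 1)
    {W : Potential (ZdEdge 4) (Matrix.specialUnitaryGroup (Fin 3) ℂ)} (hW : MemBallZdS a Λ t W) :
    (perturbedGibbsMeasuresS (d := 4) (fundamentalRep (Fin 3)) (((3 : ℕ) : ℝ) * (βW / 9)) W).Nonempty ∧
      ∀ μ ∈ perturbedGibbsMeasuresS (d := 4) (fundamentalRep (Fin 3)) (((3 : ℕ) : ℝ) * (βW / 9)) W,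
        IsMassiveState μ ∧ HasExponentialDecay (plaquetteCorrFn (fundamentalRep (Fin 3)) μ) := by
  have hP' : OneLinkPoincareSUN 3 (11 / 30) (4 / 5) := hP.mono (by norm_num) le_rfl
  have hb : |βW / 9| * (2 * ((((4 : ℕ) : ℝ)) - 1)) ≤ 11 / 30 := by
    rw [abs_div, abs_of_pos (by norm_num : (0 : ℝ) < 9)]
    nlinarith [hR, abs_nonneg βW]
  refine massive_onBallZdS_of_pair (N := 3) (by norm_num) (by norm_num) (by norm_num) hb (fun B hB => hP' B hB)
    (fun B hB => hV B hB) ht ?_ hW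
  have hsq : Real.sqrt (4 / 5 * (49 / 20 : ℝ)) = 7 / 5 := by
    rw [show (4 / 5 * (49 / 20 : ℝ)) = (7 / 5) ^ 2 by norm_num, Real.sqrt_sq (by norm_num)]
  rw [hsq, abs_div, abs_of_pos (by norm_num : (0 : ℝ) < 9)]
  calc 6 * ((((4 : ℕ) : ℝ)) - 1) * (|βW| / 9) * (Real.exp a * Real.exp t * (7 / 5)) +
        Real.exp (a / 2) * Real.sqrt (4 / 5) * Λ
      = 14 / 15 * (((((4 : ℕ) : ℝ)) - 1) * |βW|) * (Real.exp a * Real.exp t) +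
        Real.exp (a / 2) * Real.sqrt (4 / 5) * Λ := by ring
    _ < 1 := hρ

end Summit.Ventures.YMGap.RobustBall

end
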